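import Summits.ValiantsHypothesis.ValiantsHypothesis.Theorems.TwoAdicLadderPrecisionLadderLadderZTwoAdic
import Literature.Computability.AlgebraicComplexity.SharpPBitsPPolyModM

/-!
# TwoAdicLadder — crux `PrecisionLadder` (stmt-ValiantsHypothesis-5948), line `birth`,
# registered stub `stub_ladderZ`: its BOOLEAN position, GRH-free
# (route-independent: this file imports no route file)

The registered open stub of `Cruxes/PrecisionLadder/Lines/birth.lean`,

  `stub_ladderZ : ∀ c, ∃ᶠ n in atTop, ∃ k, n ^ c < complexity (perPoly (Fin n) (ZMod (2 ^ (k + 1))))`,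

is `per ∉ VP_{ℤ₂}` (`ladderZ_iff_not_isPComputable_padicInt`, `…LadderZTwoAdic.lean`) and sits below
the summit (`ladderZ_of_valiantsHypothesis`, `…LadderZVH.lean`). This file places it below the
standard BOOLEAN hypotheses as well, with NO Riemann hypothesis:

* `ladderZ_of_not_PSharpP_subset_PPoly` — **`P^{#P} ⊄ P/poly ⟹ stub_ladderZ`**;
* `ladderZ_of_not_NP_subset_PPoly` — **`NP ⊄ P/poly ⟹ stub_ladderZ`**;
* `boolGrhFree_of_padicIntNormalisation` — **`(VP_ℂ = VNP_ℂ → per ∈ VP_{ℤ₂}) ⟹ (VP_ℂ = VNP_ℂ → NP ⊆ P/poly)`**: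
  the stub's declared distance from the summit, `2`-adic integral normalisation of constants
  (the second conjunct of `valiantsHypothesis_iff_ladderZ_and_padicIntNormalisation`), implies the
  GRH-FREE Boolean transfer that route `BoolTransfer` files as its crux `BoolGrhFree`
  (stmt-ValiantsHypothesis-0345, statement reproduced verbatim as the conclusion).

Mechanism (`Literature/…/SharpPBitsPPolyModM.lean`, the modulus form of Bürgisser 2000 TCS §5 (A3)):
a polynomial-size `ℤ₂`-circuit family for `per` reduces modulo `2^{N+1} > N! ≥ per(A)`,
`A ∈ {0,1}^{N×N}`, along `PadicInt.toZModPow`; the `ℤ/2^{N+1}`-constants are advice and the ring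
arithmetic is Boolean-simulable, so `#P ⊆ FP/poly`. For COMPLEX constants the same conclusion is
Bürgisser's Cor. 1.2 and needs GRH (to find a small prime modulo which the algebraic constants
reduce); over `ℤ₂` no prime has to be found — which is exactly why the `2`-adic residual trades the
number-theoretic hypothesis of the characteristic-zero Boolean transfer for an algebraic one.

So, in strength (all kernel, all unconditional):
`VH ⟹ stub ⟸ P^{#P} ⊄ P/poly ⟸ NP ⊄ P/poly`, and
`TauConstElim-type normalisations ⟹ (VP=VNP → per ∈ VP_{ℤ₂}) ⟹ BoolGrhFree`.

Honest framing (rung currency): calibration of an OPEN stub and of an OPEN crux of another route; no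
rung is proved; `stub_ladderZ`, `PrecisionLadder`, `BoolGrhFree`, `P^{#P} ⊄ P/poly` and `VP ≠ VNP`
are NOT proved and nothing here is progress on them. No new definitions, no named facts, no sorry.

## References

* P. Bürgisser, *Cook's versus Valiant's hypothesis*, Theoret. Comput. Sci. 235 (2000) 71–88,
  §5 (A3) p. 86 (Boolean simulation modulo an advice prime), Cor. 1.2 p. 74 (the GRH-conditional
  characteristic-zero transfer). [cite: Burgisser2000TCS, §5 (A3) p. 86]
* P. Bürgisser, *Completeness and Reduction in Algebraic Complexity Theory* (2000), §4.1 (extension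
  of scalars). [cite: Burgisser2000, §4.1]
-/

noncomputable section

open MvPolynomial

-- the summit and the problem share the name `ValiantsHypothesis` (D-0017 single-conjunct layout)
set_option linter.dupNamespace false

namespace Summit.ValiantsHypothesis.ValiantsHypothesis.Theorems.TwoAdicLadderPrecisionLadder

open Filter Literature.Computability.AlgebraicComplexity Literature.Computability.Complexity

/-- **`P^{#P} ⊄ P/poly ⟹ stub_ladderZ`**, unconditionally: if the stub fails, `per ∈ VP_{ℤ₂}`
(`ladderZ_iff_not_isPComputable_padicInt`), and cheap permanents with `2`-adic integer constants
put `P^{#P}` in `P/poly` (`PSharpP_subset_PPoly_of_isPComputable_perPoly_padicInt`: reduce modulo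
`2^{N+1}`, Boolean simulation with the residues of the constants as advice — no prime to find, no
GRH). Calibration only; neither side is proved. [cite: Burgisser2000TCS, §5 (A3) p. 86] -/
theorem ladderZ_of_not_PSharpP_subset_PPoly (h : ¬ (PSharpP ⊆ PPoly)) :
    ∀ c : ℕ, ∃ᶠ n in atTop, ∃ k : ℕ,
      n ^ c < complexity (perPoly (Fin n) (ZMod (2 ^ (k + 1)))) :=
  ladderZ_iff_not_isPComputable_padicInt.2
    (not_isPComputable_perPoly_padicInt_of_not_PSharpP_subset_PPoly 2 h)

/-- **`NP ⊄ P/poly ⟹ stub_ladderZ`**, unconditionally (`NP ⊆ P^{#P}`). So the registered stub of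
the crux `PrecisionLadder` is implied by each of `VP_ℂ ≠ VNP_ℂ` (`ladderZ_of_valiantsHypothesis`),
`P^{#P} ⊄ P/poly` and `NP ⊄ P/poly`, with no Riemann hypothesis anywhere. Calibration only.
[cite: Burgisser2000TCS, §5 (A3) p. 86] -/
theorem ladderZ_of_not_NP_subset_PPoly (h : ¬ (Nondeterministic.NP ⊆ PPoly)) :
    ∀ c : ℕ, ∃ᶠ n in atTop, ∃ k : ℕ,
      n ^ c < complexity (perPoly (Fin n) (ZMod (2 ^ (k + 1)))) :=
  ladderZ_of_not_PSharpP_subset_PPoly fun hP => h fun _L hL => hP (NP_subset_PSharpP_holds hL)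

/-- **`2`-adic integral normalisation ⟹ the GRH-free Boolean transfer.** If `VP_ℂ = VNP_ℂ` forces
the permanent to be p-computable with `2`-adic INTEGER constants (the stub's declared distance from
the summit: the second conjunct of `valiantsHypothesis_iff_ladderZ_and_padicIntNormalisation`), then
`VP_ℂ = VNP_ℂ → NP ⊆ P/poly` — the statement of route `BoolTransfer`'s crux `BoolGrhFree`
(stmt-ValiantsHypothesis-0345), verbatim. Both sides are implications out of `VP_ℂ = VNP_ℂ`, hence
vacuous under VH; the content is that `2`-adic integrality of the collapse is one more GRH-free
SUFFICIENT condition for Bürgisser's characteristic-zero Boolean transfer (TCS 2000 Cor. 1.2, there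
under GRH). Calibration only; neither side is proved. [cite: Burgisser2000TCS, Cor. 1.2 p. 74; §5 (A3) p. 86] -/
theorem boolGrhFree_of_padicIntNormalisation
    (hN : VP ℂ = VNP ℂ → IsPComputable (fun n => perPoly (Fin n) ℤ_[2])) :
    Literature.Computability.AlgebraicComplexity.VP ℂ =
        Literature.Computability.AlgebraicComplexity.VNP ℂ →
      Literature.Computability.Complexity.Nondeterministic.NP ⊆
        Literature.Computability.Complexity.PPoly :=
  fun hEq => NP_subset_PPoly_of_isPComputable_perPoly_padicInt 2 (hN hEq)

/-- The same for any prime `p`: **`p`-adic integral normalisation of the collapse, for a single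
prime `p`, already gives `VP_ℂ = VNP_ℂ → NP ⊆ P/poly`** with no Riemann hypothesis. Calibration
only. [cite: Burgisser2000TCS, Cor. 1.2 p. 74; §5 (A3) p. 86] -/
theorem boolGrhFree_of_padicIntNormalisation_prime (p : ℕ) [Fact p.Prime]
    (hN : VP ℂ = VNP ℂ → IsPComputable (fun n => perPoly (Fin n) ℤ_[p])) :
    Literature.Computability.AlgebraicComplexity.VP ℂ =
        Literature.Computability.AlgebraicComplexity.VNP ℂ →
      Literature.Computability.Complexity.Nondeterministic.NP ⊆
        Literature.Computability.Complexity.PPoly :=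
  fun hEq => NP_subset_PPoly_of_isPComputable_perPoly_padicInt p (hN hEq)

/-- **Summary square** (kernel restatement for the record): the summit splits as
`VH ↔ stub_ladderZ ∧ (VP_ℂ = VNP_ℂ → per ∈ VP_{ℤ₂})`
(`valiantsHypothesis_iff_ladderZ_and_padicIntNormalisation`), its hard conjunct is implied by
`P^{#P} ⊄ P/poly`, and its normalisation conjunct implies `VP_ℂ = VNP_ℂ → P^{#P} ⊆ P/poly` — all
GRH-free. Calibration only; nothing here is proved about either conjunct. [cite: Burgisser2000TCS, §5 (A3) p. 86] -/
theorem ladderZ_boolean_position :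
    (¬ (PSharpP ⊆ PPoly) →
        ∀ c : ℕ, ∃ᶠ n in atTop, ∃ k : ℕ,
          n ^ c < complexity (perPoly (Fin n) (ZMod (2 ^ (k + 1))))) ∧
      ((VP ℂ = VNP ℂ → IsPComputable (fun n => perPoly (Fin n) ℤ_[2])) →
        (VP ℂ = VNP ℂ → PSharpP ⊆ PPoly)) :=
  ⟨ladderZ_of_not_PSharpP_subset_PPoly,
    fun hN hEq => PSharpP_subset_PPoly_of_isPComputable_perPoly_padicInt 2 (hN hEq)⟩

end Summit.ValiantsHypothesis.ValiantsHypothesis.Theorems.TwoAdicLadderPrecisionLadder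

end
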